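import Summits.QuantumFields.BalabanUV.Beta.FP.TorusCombSlots
import Summits.QuantumFields.BalabanUV.Beta.FP.TorusCombNestedBasis
import Summits.QuantumFields.BalabanUV.Beta.FP.CombSliceJetLetters

/-!
# `BalabanUV.Beta.FP.CombSliceRowJets` — road «FP» for binder row D1, ROUTE T, TID-LETTER-SPEC § B (v) ∕ (v-H): **THE ONE-SHOT FADDEEV–POPOV 2-JET
# ALONG A ROW-ULTRALOCAL GENERATOR JET, IN CLOSED FORM** — for the static one-shot comb slice `P` (comb rows re-indexed by any `e : Res ≃ o`, read on the
# field slots) and generator jets `W₁ W₂` supported on ONE field-slot row `b` (the insertion bond; leaf-02's F-d1leaf02g17-1 ∕ the OWNER's (O1):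
# `W₁^{(b)} = −(row b) ⊗ […]`), the displayed defect term `secondVar (P·W₀) (P·W₁) (P·W₂)` of `NestedStepLawOneShotJets.secondVar_oneShot_nestedStepLaw_jets`
# (p308750) is
#   * `0` if the insertion slot `b = (s, α)` is LIVE for the one-shot chart (`¬ IsCombBondAt ρ N α s`: no comb bond of the big comb sits there) — for ANY `W₀`;
#   * `d₂ − d₁²` with `dₖ := Wₖ b ⬝ᵥ ((P·W₀)⁻¹ ▸ column e x)` if `b` is DEAD, i.e. `(s, inl α) = combBondT x` is the comb bond into the residual parameter `x`
#     (the OWNER's per-site letter «`d₀d₂ = d₁²`» with `d₀` normalised into `(P·W₀)⁻¹`; for the tables' linear shadow `W₂ = 0` the defect is `−d₁²`).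
# Pure rank-one algebra: `P·Wₖ = (column b of P) ⊗ (row b of Wₖ)` and `secondVar A₀ (u ⊗ w₁) (u ⊗ w₂) = w₂·A₀⁻¹u − (w₁·A₀⁻¹u)²`; the comb enters only through
# «column `(s, inl α)` of the re-indexed comb rows is `0` (live) or the basis vector `e x` (dead, `combBondT` injective)».

HONEST DEPENDENCY (page 1, mandatory): continuum YM on T⁴ ⇐ BetaPertH ∧ nine spine estimates (0/9 proved); BetaPertH ⇐ (D1) ∧ (D4) ∧ CAP+tail;
G-an2-4 gates asym, D1 and NE2/3/4.  HONEST FRAMING (cell contract, verbatim): «discharging `BetaPertH` makes Bałaban's UV stability UNCONDITIONAL —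
a real constructive-QFT result; it is NOT the continuum limit and NOT the Clay problem.»  ABSOLUTE RULE (cell charter, verbatim): «No internally-minted
statement may enter as a cited fact. Every hypothesis is either kernel-proved in this package or a verbatim quotation of a PUBLISHED theorem with page
reference. The manuscript(s) under audit are NOT citable for their own disputed steps — they are the thing under adjudication; programme-internal
(2001/route/tribunal) claims are never citable.»  THIS MODULE is [folklore] finite-matrix algebra (`Matrix.vecMulVec`, `Matrix.trace_vecMulVec`,
`Matrix.mul_vecMulVec`, `Pi.single`) over `FP/TorusCombRows` ∕ `FP/TorusCombSlots` ∕ `FP/TorusCombNestedBasis` ∕ `FP/CombSliceJetLetters` (`secondVar_zero_jets` REUSED)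
and road BF-x's `LogDetSecondVariation.secondVar`;
no `def`, no `def … : Prop`, nothing cited, 0 sorry; 0 estimates; 0∕4 row-D1 binders.  NOT the value of `d₁ d₂` at the dictionary's jets (that needs the
DEFINED `W₁^{(b)} W₂^{(b)}` — leaf-02's OFFER O-d1leaf02g17-3 — and the explicit inverse of the unipotent `P·W₀`), NOT the nested FP 2-jet (its `[τ₂Q₁₁;0]·W₀`
summand is not rank one), NOT (T-ID), NOT SDF, NOT D1, NOT BetaPertH, NOT continuum, NOT Clay.  «not in print; our bookkeeping».

CONTENT.
* §1 generic (`ι o ν σ` finite types, real matrices): `mul_of_rowSupported` (`P·W = (P▸col b) ⊗ (W b)` for `W` supported on row `b`),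
  **`secondVar_vecMulVec`** (`secondVar A₀ (u⊗w₁) (u⊗w₂) = w₂ ⬝ᵥ A₀⁻¹u − (w₁ ⬝ᵥ A₀⁻¹u)²`), `secondVar_single_row_jets` (`u = e_x`: the column `x` of `A₀⁻¹`),
  `secondVar_rowJets_of_col_eq_zero` ∕ `secondVar_rowJets_of_col_eq_single` (the two cases for `P·W₀, P·W₁, P·W₂`).
* §2 the comb column at a field slot (`e : Res ρ N M ≃ o` any re-indexing): `combRowsT_reindex_fieldSlot_apply`; LIVE slot ⇒ zero column
  (`combRowsT_reindex_col_eq_zero(_of_not_isCombBondAt)`); DEAD slot ⇒ `Pi.single (e x) 1` (`combRowsT_reindex_col_eq_single`, `combBondT_injective`);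
  `isCombBondAt_of_combBondT_eq`, `exists_combBondT_eq_of_isCombBondAt` (dead slots are exactly the comb bonds `combBondT x`, via `TorusCombSlots.childOf`).
* §3 **THE ONE-SHOT FP 2-JET ALONG A ROW-ULTRALOCAL JET**: `secondVar_combSlice_rowJets_eq_zero_of_live` (ANY `W₀`), `secondVar_combSlice_rowJets_eq_of_dead`
  (`= d₂ − d₁²`), and the `IsCombBondAt`-phrased forms; and the OWNER's (O2) as a theorem: **`secondVar_combSlice_jets_eq_zero_of_vanish_on_dead`** ∕
  `…_of_vanish_on_combSlots` — ANY jets `W₁ W₂` vanishing on the dead slots give a zero one-shot FP 2-jet (`combSlice_mul_eq_zero_of_vanish_on_dead`, §2).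
* §4 AT THE TORUS CALL's LITERAL `P` (the BIG comb `((N:ℤ)•ρ₂ + ρ, N·N₂, fine N M′)` re-indexed by `TorusCombNestedBasis.resBigEquiv`, field slots of the fine box):
  `secondVar_bigCombSlice_rowJets_eq_zero_of_live`, `secondVar_bigCombSlice_rowJets_eq_of_dead`, **`secondVar_bigCombSlice_jets_eq_zero_of_vanish_on_dead`**
  (presentation T-α of W-FP-17-11: along `Π_big e_b` the jets have no big-dead component ⇒ the displayed one-shot FP term of the torus call is `0`).
Provenance: D1 formalisation swarm LEAF PROVER 06, unit b2b-balaban-beta-d1-formalise-leaf-06 gen 17, 2026-08-22 (first refusal on § B (v), TID-LETTER-SPEC v1.2 § D;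
OWNER A1 to I-FP-17-8 [D1P3-G17-INTENT8-A1]: generators MOVE ultralocally, FP defect DISPLAYED).  No existing file touched.
-/

noncomputable section

namespace Summit.QuantumFields.BalabanUV.Beta.FP.CombSliceRowJets

open Finset Matrix
open Literature.MathematicalPhysics.QuantumFieldTheory.Balaban1983to89
open Literature.MathematicalPhysics.QuantumFieldTheory.Balaban1983to89.Beta
open B5Prop11Plancherel (fine)
open AffineAveraging (Site)
open B6Lemma24Torus (pbox)
open OneStepResolventKernel (Fib)
open Summit.QuantumFields.BalabanUV.Beta.AxialDressingRooted (IsCombBondAt)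
open Summit.QuantumFields.BalabanUV.Beta.D1BFx.LogDetSecondVariation (secondVar)
open Summit.QuantumFields.BalabanUV.Beta.FP.KernelPeriodisationFib (Idx)
open Summit.QuantumFields.BalabanUV.Beta.FP.TorusCombRows (Res combBondT combRowsT)
open Summit.QuantumFields.BalabanUV.Beta.FP.TorusCombSlots (childOf combSlotOf combSlotOf_val combSlotOf_childOf combBondT_injective)
open Summit.QuantumFields.BalabanUV.Beta.FP.TorusCombNestedBasis (resBigEquiv bigRoot_bounds fine_dvd)
open Summit.QuantumFields.BalabanUV.Beta.FP.CombSliceJetLetters (secondVar_zero_jets)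

variable {d : ℕ}

/-! ## §1 Generic: rank-one row jets -/

section Generic

variable {ι o ν σ : Type*} [Fintype ι] [DecidableEq ι] [Fintype o] [DecidableEq o] [Fintype ν]

omit [Fintype o] [DecidableEq o] in
/-- [folklore] **A MATRIX SUPPORTED ON ONE ROW FACTORS EVERY PRODUCT THROUGH A RANK-ONE MATRIX**: if `W q = 0` for `q ≠ b` then `P·W = (P▸column b) ⊗ (W b)`. -/
theorem mul_of_rowSupported (P : Matrix o ν ℝ) (W : Matrix ν σ ℝ) (b : ν) (hW : ∀ q, q ≠ b → W q = 0) :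
    P * W = vecMulVec (fun i => P i b) (W b) := by
  ext i c
  rw [Matrix.mul_apply, vecMulVec_apply, Finset.sum_eq_single b]
  · intro q _ hq
    rw [hW q hq, Pi.zero_apply, mul_zero]
  · intro h
    exact absurd (Finset.mem_univ b) h

/-- [folklore] **SECOND VARIATION OF `log|det|` ALONG RANK-ONE JETS WITH A COMMON COLUMN**:
`secondVar A₀ (u ⊗ w₁) (u ⊗ w₂) = w₂ ⬝ᵥ (A₀⁻¹u) − (w₁ ⬝ᵥ (A₀⁻¹u))²` (`secondVar A₀ A₁ A₂ = tr(A₀⁻¹A₂) − tr((A₀⁻¹A₁)²)`; no invertibility needed). -/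
theorem secondVar_vecMulVec (A₀ : Matrix ι ι ℝ) (u w₁ w₂ : ι → ℝ) :
    secondVar A₀ (vecMulVec u w₁) (vecMulVec u w₂) = w₂ ⬝ᵥ (A₀⁻¹ *ᵥ u) - (w₁ ⬝ᵥ (A₀⁻¹ *ᵥ u)) ^ 2 := by
  have h1 : A₀⁻¹ * vecMulVec u w₂ = vecMulVec (A₀⁻¹ *ᵥ u) w₂ := mul_vecMulVec _ _ _
  have h2 : A₀⁻¹ * vecMulVec u w₁ = vecMulVec (A₀⁻¹ *ᵥ u) w₁ := mul_vecMulVec _ _ _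
  rw [secondVar, h1, h2, vecMulVec_mul_vecMulVec, trace_vecMulVec, trace_vecMulVec, dotProduct_smul, smul_eq_mul,
    dotProduct_comm _ w₂, dotProduct_comm _ w₁, sq]

/-- [folklore] **ROW-ULTRALOCAL JETS AT ROW `x`**: `secondVar A₀ (e_x ⊗ w₁) (e_x ⊗ w₂) = w₂ ⬝ᵥ c_x − (w₁ ⬝ᵥ c_x)²` with `c_x := (fun c ↦ A₀⁻¹ c x)` the
column `x` of `A₀⁻¹` (the OWNER's «`d₂ − d₁²`» with `d₀` normalised away). -/
theorem secondVar_single_row_jets (A₀ : Matrix ι ι ℝ) (x : ι) (w₁ w₂ : ι → ℝ) :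
    secondVar A₀ (vecMulVec (Pi.single x 1) w₁) (vecMulVec (Pi.single x 1) w₂)
      = w₂ ⬝ᵥ (fun c => A₀⁻¹ c x) - (w₁ ⬝ᵥ fun c => A₀⁻¹ c x) ^ 2 := by
  rw [secondVar_vecMulVec, mulVec_single_one]
  rfl

/-- [folklore] **CASE «LIVE»**: if column `b` of `P` vanishes and `W₁ W₂` are supported on row `b`, then `secondVar (P·W₀) (P·W₁) (P·W₂) = 0` for ANY `W₀`. -/
theorem secondVar_rowJets_of_col_eq_zero (P : Matrix o ν ℝ) (W₀ W₁ W₂ : Matrix ν o ℝ) (b : ν)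
    (hW₁ : ∀ q, q ≠ b → W₁ q = 0) (hW₂ : ∀ q, q ≠ b → W₂ q = 0) (hP : ∀ i, P i b = 0) :
    secondVar (P * W₀) (P * W₁) (P * W₂) = 0 := by
  have h0 : (fun i => P i b) = 0 := funext hP
  rw [mul_of_rowSupported P W₁ b hW₁, mul_of_rowSupported P W₂ b hW₂, h0, zero_vecMulVec, zero_vecMulVec, secondVar_zero_jets]

/-- [folklore] **CASE «DEAD»**: if column `b` of `P` is the basis vector `e_x` and `W₁ W₂` are supported on row `b`, then
`secondVar (P·W₀) (P·W₁) (P·W₂) = W₂ b ⬝ᵥ c − (W₁ b ⬝ᵥ c)²` with `c := (fun c ↦ (P·W₀)⁻¹ c x)`. -/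
theorem secondVar_rowJets_of_col_eq_single (P : Matrix o ν ℝ) (W₀ W₁ W₂ : Matrix ν o ℝ) (b : ν) (x : o)
    (hW₁ : ∀ q, q ≠ b → W₁ q = 0) (hW₂ : ∀ q, q ≠ b → W₂ q = 0) (hP : (fun i => P i b) = Pi.single x 1) :
    secondVar (P * W₀) (P * W₁) (P * W₂) = W₂ b ⬝ᵥ (fun c => (P * W₀)⁻¹ c x) - (W₁ b ⬝ᵥ fun c => (P * W₀)⁻¹ c x) ^ 2 := by
  rw [mul_of_rowSupported P W₁ b hW₁, mul_of_rowSupported P W₂ b hW₂, hP, secondVar_single_row_jets]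

end Generic

/-! ## §2 The comb column at a field slot: zero (live) or a basis vector (dead) -/

section Comb

variable {N : ℕ} {ρ : Site (d + 1)} {M : Fin (d + 1) → ℕ} {o : Type*}

/-- [folklore] entry of the re-indexed comb rows read on the field slots: the indicator of «the comb bond into `e.symm i` is the slot `(b.1, inl b.2)`». -/
theorem combRowsT_reindex_fieldSlot_apply (e : Res ρ N M ≃ o) (i : o) (b : ↥(pbox M) × Fin (d + 1)) :
    (combRowsT ρ N M).submatrix e.symm (fun b : ↥(pbox M) × Fin (d + 1) => ((b.1, Sum.inl b.2) : Idx M (Fib d))) i b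
      = if ((b.1, Sum.inl b.2) : Idx M (Fib d)) = combBondT ρ N M (e.symm i) then 1 else 0 := rfl

/-- [folklore] **LIVE SLOT ⇒ ZERO COLUMN**: if no comb bond sits at the field slot `b`, column `b` of the re-indexed comb rows vanishes. -/
theorem combRowsT_reindex_col_eq_zero (e : Res ρ N M ≃ o) {b : ↥(pbox M) × Fin (d + 1)}
    (hb : ∀ x : Res ρ N M, combBondT ρ N M x ≠ ((b.1, Sum.inl b.2) : Idx M (Fib d))) (i : o) :
    (combRowsT ρ N M).submatrix e.symm (fun b : ↥(pbox M) × Fin (d + 1) => ((b.1, Sum.inl b.2) : Idx M (Fib d))) i b = 0 := by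
  rw [combRowsT_reindex_fieldSlot_apply, if_neg (fun h => hb _ h.symm)]

/-- [folklore] **DEAD SLOT ⇒ BASIS COLUMN**: if the field slot `b` is the comb bond into `x`, column `b` of the re-indexed comb rows is `Pi.single (e x) 1`
(`combBondT` is injective under `0 < N`, `0 ≤ ρ < N`, `N ∣ M`). -/
theorem combRowsT_reindex_col_eq_single [DecidableEq o] (hN : 0 < N) (hρ : ∀ i, 0 ≤ ρ i ∧ ρ i < N) (hM : ∀ i, N ∣ M i) (e : Res ρ N M ≃ o)
    {b : ↥(pbox M) × Fin (d + 1)} {x : Res ρ N M} (hb : combBondT ρ N M x = ((b.1, Sum.inl b.2) : Idx M (Fib d))) :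
    (fun i => (combRowsT ρ N M).submatrix e.symm (fun b : ↥(pbox M) × Fin (d + 1) => ((b.1, Sum.inl b.2) : Idx M (Fib d))) i b)
      = Pi.single (e x) 1 := by
  funext i
  rw [combRowsT_reindex_fieldSlot_apply]
  by_cases hi : i = e x
  · subst hi
    rw [Equiv.symm_apply_apply, if_pos hb.symm, Pi.single_eq_same]
  · rw [Pi.single_eq_of_ne hi, if_neg]
    intro h
    apply hi
    have hx : x = e.symm i := combBondT_injective hN hρ hM (hb.trans h)
    rw [hx, Equiv.apply_symm_apply]

/-- [folklore] a field slot carrying a comb bond `combBondT x` is a comb slot of an2's chart (`IsCombBondAt` at its axis). -/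
theorem isCombBondAt_of_combBondT_eq (hN : 0 < N) (hρ : ∀ i, 0 ≤ ρ i ∧ ρ i < N) (hM : ∀ i, N ∣ M i)
    {b : ↥(pbox M) × Fin (d + 1)} {x : Res ρ N M} (hb : combBondT ρ N M x = ((b.1, Sum.inl b.2) : Idx M (Fib d))) :
    IsCombBondAt ρ N b.2 (b.1 : Site (d + 1)) := by
  obtain ⟨m, hm, hc⟩ := (combSlotOf ρ N M hN hρ hM x).2
  rw [combSlotOf_val, hb] at hm hc
  have hm' : b.2 = m := Sum.inl_injective hm
  rw [hm']
  exact hc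

/-- [folklore] conversely a comb slot `(s, α)` (`IsCombBondAt ρ N α s`) IS the comb bond into a residual parameter (its child, `TorusCombSlots.childOf`). -/
theorem exists_combBondT_eq_of_isCombBondAt (hN : 0 < N) (hρ : ∀ i, 0 ≤ ρ i ∧ ρ i < N) (hM : ∀ i, N ∣ M i)
    {b : ↥(pbox M) × Fin (d + 1)} (hb : IsCombBondAt ρ N b.2 (b.1 : Site (d + 1))) :
    ∃ x : Res ρ N M, combBondT ρ N M x = ((b.1, Sum.inl b.2) : Idx M (Fib d)) := by
  refine ⟨childOf ρ N M hN hM ⟨((b.1, Sum.inl b.2) : Idx M (Fib d)), ⟨b.2, rfl, hb⟩⟩, ?_⟩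
  have h := congrArg Subtype.val (combSlotOf_childOf hN hρ hM (⟨((b.1, Sum.inl b.2) : Idx M (Fib d)), ⟨b.2, rfl, hb⟩⟩ : TorusCombSlots.CombSlot ρ N M))
  rw [combSlotOf_val] at h
  exact h

/-- [folklore] LIVE in an2's words: `¬ IsCombBondAt ρ N α s` ⇒ no comb bond sits at `(s, α)`. -/
theorem combBondT_ne_of_not_isCombBondAt (hN : 0 < N) (hρ : ∀ i, 0 ≤ ρ i ∧ ρ i < N) (hM : ∀ i, N ∣ M i)
    {b : ↥(pbox M) × Fin (d + 1)} (hb : ¬ IsCombBondAt ρ N b.2 (b.1 : Site (d + 1))) (x : Res ρ N M) :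
    combBondT ρ N M x ≠ ((b.1, Sum.inl b.2) : Idx M (Fib d)) :=
  fun h => hb (isCombBondAt_of_combBondT_eq hN hρ hM h)

/-- [folklore] **A MATRIX VANISHING ON THE DEAD SLOTS IS KILLED BY THE COMB SLICE**: if `W b = 0` at every field slot `b` carrying a comb bond
(`(b.1, inl b.2) = combBondT x`), then `P·W = 0` for the re-indexed comb rows `P` — the OWNER's (O2) «`P` reads big-dead bonds» (W-FP-17-11 (2):
along the one-shot directions `Π_big e_b` the generator jets have no dead component). -/
theorem combSlice_mul_eq_zero_of_vanish_on_dead [Fintype o] (e : Res ρ N M ≃ o) {σ : Type*} (W : Matrix (↥(pbox M) × Fin (d + 1)) σ ℝ)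
    (hW : ∀ (b : ↥(pbox M) × Fin (d + 1)) (x : Res ρ N M), combBondT ρ N M x = ((b.1, Sum.inl b.2) : Idx M (Fib d)) → W b = 0) :
    (combRowsT ρ N M).submatrix e.symm (fun b : ↥(pbox M) × Fin (d + 1) => ((b.1, Sum.inl b.2) : Idx M (Fib d))) * W = 0 := by
  ext i c
  rw [Matrix.mul_apply, Matrix.zero_apply]
  refine Finset.sum_eq_zero fun b _ => ?_
  rw [combRowsT_reindex_fieldSlot_apply]
  by_cases h : ((b.1, Sum.inl b.2) : Idx M (Fib d)) = combBondT ρ N M (e.symm i)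
  · rw [hW b (e.symm i) h.symm, Pi.zero_apply, mul_zero]
  · rw [if_neg h, zero_mul]

end Comb

/-! ## §3 The one-shot Faddeev–Popov 2-jet along a row-ultralocal generator jet -/

section OneShot

variable {N : ℕ} {ρ : Site (d + 1)} {M : Fin (d + 1) → ℕ} {o : Type*} [Fintype o] [DecidableEq o]

/-- [folklore] **LIVE INSERTION SLOT ⇒ ZERO ONE-SHOT FP 2-JET, FOR ANY `W₀`**: with `P` the comb rows re-indexed by `e` and read on the field slots, and
`W₁ W₂` supported on the single row `b` with no comb bond at `b`, `secondVar (P·W₀) (P·W₁) (P·W₂) = 0`. -/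
theorem secondVar_combSlice_rowJets_eq_zero_of_live (e : Res ρ N M ≃ o)
    (W₀ W₁ W₂ : Matrix (↥(pbox M) × Fin (d + 1)) o ℝ) {b : ↥(pbox M) × Fin (d + 1)}
    (hW₁ : ∀ q, q ≠ b → W₁ q = 0) (hW₂ : ∀ q, q ≠ b → W₂ q = 0)
    (hb : ∀ x : Res ρ N M, combBondT ρ N M x ≠ ((b.1, Sum.inl b.2) : Idx M (Fib d))) :
    secondVar ((combRowsT ρ N M).submatrix e.symm (fun b : ↥(pbox M) × Fin (d + 1) => ((b.1, Sum.inl b.2) : Idx M (Fib d))) * W₀)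
        ((combRowsT ρ N M).submatrix e.symm (fun b : ↥(pbox M) × Fin (d + 1) => ((b.1, Sum.inl b.2) : Idx M (Fib d))) * W₁)
        ((combRowsT ρ N M).submatrix e.symm (fun b : ↥(pbox M) × Fin (d + 1) => ((b.1, Sum.inl b.2) : Idx M (Fib d))) * W₂) = 0 :=
  secondVar_rowJets_of_col_eq_zero _ W₀ W₁ W₂ b hW₁ hW₂ (combRowsT_reindex_col_eq_zero e hb)

/-- [folklore] **DEAD INSERTION SLOT ⇒ THE ONE-SHOT FP 2-JET IS `d₂ − d₁²`**: with `P` as above, `W₁ W₂` supported on the row `b = combBondT x` (the comb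
bond into the residual parameter `x`), `secondVar (P·W₀) (P·W₁) (P·W₂) = W₂ b ⬝ᵥ c − (W₁ b ⬝ᵥ c)²`, `c := (fun c ↦ (P·W₀)⁻¹ c (e x))`. -/
theorem secondVar_combSlice_rowJets_eq_of_dead (hN : 0 < N) (hρ : ∀ i, 0 ≤ ρ i ∧ ρ i < N) (hM : ∀ i, N ∣ M i) (e : Res ρ N M ≃ o)
    (W₀ W₁ W₂ : Matrix (↥(pbox M) × Fin (d + 1)) o ℝ) {b : ↥(pbox M) × Fin (d + 1)}
    (hW₁ : ∀ q, q ≠ b → W₁ q = 0) (hW₂ : ∀ q, q ≠ b → W₂ q = 0)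
    {x : Res ρ N M} (hb : combBondT ρ N M x = ((b.1, Sum.inl b.2) : Idx M (Fib d))) :
    secondVar ((combRowsT ρ N M).submatrix e.symm (fun b : ↥(pbox M) × Fin (d + 1) => ((b.1, Sum.inl b.2) : Idx M (Fib d))) * W₀)
        ((combRowsT ρ N M).submatrix e.symm (fun b : ↥(pbox M) × Fin (d + 1) => ((b.1, Sum.inl b.2) : Idx M (Fib d))) * W₁)
        ((combRowsT ρ N M).submatrix e.symm (fun b : ↥(pbox M) × Fin (d + 1) => ((b.1, Sum.inl b.2) : Idx M (Fib d))) * W₂)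
      = W₂ b ⬝ᵥ (fun c => ((combRowsT ρ N M).submatrix e.symm
            (fun b : ↥(pbox M) × Fin (d + 1) => ((b.1, Sum.inl b.2) : Idx M (Fib d))) * W₀)⁻¹ c (e x))
        - (W₁ b ⬝ᵥ fun c => ((combRowsT ρ N M).submatrix e.symm
            (fun b : ↥(pbox M) × Fin (d + 1) => ((b.1, Sum.inl b.2) : Idx M (Fib d))) * W₀)⁻¹ c (e x)) ^ 2 :=
  secondVar_rowJets_of_col_eq_single _ W₀ W₁ W₂ b (e x) hW₁ hW₂ (combRowsT_reindex_col_eq_single hN hρ hM e hb)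

/-- [folklore] the LIVE case in an2's words (`¬ IsCombBondAt ρ N α s` at the insertion slot `b = (s, α)`). -/
theorem secondVar_combSlice_rowJets_eq_zero_of_not_isCombBondAt (hN : 0 < N) (hρ : ∀ i, 0 ≤ ρ i ∧ ρ i < N) (hM : ∀ i, N ∣ M i)
    (e : Res ρ N M ≃ o) (W₀ W₁ W₂ : Matrix (↥(pbox M) × Fin (d + 1)) o ℝ) {b : ↥(pbox M) × Fin (d + 1)}
    (hW₁ : ∀ q, q ≠ b → W₁ q = 0) (hW₂ : ∀ q, q ≠ b → W₂ q = 0) (hb : ¬ IsCombBondAt ρ N b.2 (b.1 : Site (d + 1))) :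
    secondVar ((combRowsT ρ N M).submatrix e.symm (fun b : ↥(pbox M) × Fin (d + 1) => ((b.1, Sum.inl b.2) : Idx M (Fib d))) * W₀)
        ((combRowsT ρ N M).submatrix e.symm (fun b : ↥(pbox M) × Fin (d + 1) => ((b.1, Sum.inl b.2) : Idx M (Fib d))) * W₁)
        ((combRowsT ρ N M).submatrix e.symm (fun b : ↥(pbox M) × Fin (d + 1) => ((b.1, Sum.inl b.2) : Idx M (Fib d))) * W₂) = 0 :=
  secondVar_combSlice_rowJets_eq_zero_of_live e W₀ W₁ W₂ hW₁ hW₂ (combBondT_ne_of_not_isCombBondAt hN hρ hM hb)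

/-- [folklore] the DEAD case in an2's words: at a comb slot the defect is `d₂ − d₁²` for the residual parameter `x` whose comb bond it is (exists, `§2`). -/
theorem secondVar_combSlice_rowJets_eq_of_isCombBondAt (hN : 0 < N) (hρ : ∀ i, 0 ≤ ρ i ∧ ρ i < N) (hM : ∀ i, N ∣ M i)
    (e : Res ρ N M ≃ o) (W₀ W₁ W₂ : Matrix (↥(pbox M) × Fin (d + 1)) o ℝ) {b : ↥(pbox M) × Fin (d + 1)}
    (hW₁ : ∀ q, q ≠ b → W₁ q = 0) (hW₂ : ∀ q, q ≠ b → W₂ q = 0) (hb : IsCombBondAt ρ N b.2 (b.1 : Site (d + 1))) :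
    ∃ x : Res ρ N M, combBondT ρ N M x = ((b.1, Sum.inl b.2) : Idx M (Fib d)) ∧
      secondVar ((combRowsT ρ N M).submatrix e.symm (fun b : ↥(pbox M) × Fin (d + 1) => ((b.1, Sum.inl b.2) : Idx M (Fib d))) * W₀)
          ((combRowsT ρ N M).submatrix e.symm (fun b : ↥(pbox M) × Fin (d + 1) => ((b.1, Sum.inl b.2) : Idx M (Fib d))) * W₁)
          ((combRowsT ρ N M).submatrix e.symm (fun b : ↥(pbox M) × Fin (d + 1) => ((b.1, Sum.inl b.2) : Idx M (Fib d))) * W₂)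
        = W₂ b ⬝ᵥ (fun c => ((combRowsT ρ N M).submatrix e.symm
              (fun b : ↥(pbox M) × Fin (d + 1) => ((b.1, Sum.inl b.2) : Idx M (Fib d))) * W₀)⁻¹ c (e x))
          - (W₁ b ⬝ᵥ fun c => ((combRowsT ρ N M).submatrix e.symm
              (fun b : ↥(pbox M) × Fin (d + 1) => ((b.1, Sum.inl b.2) : Idx M (Fib d))) * W₀)⁻¹ c (e x)) ^ 2 := by
  obtain ⟨x, hx⟩ := exists_combBondT_eq_of_isCombBondAt hN hρ hM hb
  exact ⟨x, hx, secondVar_combSlice_rowJets_eq_of_dead hN hρ hM e W₀ W₁ W₂ hW₁ hW₂ hx⟩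

/-- [folklore] **GENERATOR JETS WITHOUT DEAD COMPONENTS ⇒ ZERO ONE-SHOT FP 2-JET, FOR ANY `W₀`** (the OWNER's (O2), presentation T-α of W-FP-17-11: along
`Π_big e_b` the jets `W₁ W₂` vanish on every big-dead slot, so `P·W₁ = P·W₂ = 0`). -/
theorem secondVar_combSlice_jets_eq_zero_of_vanish_on_dead (e : Res ρ N M ≃ o) (W₀ W₁ W₂ : Matrix (↥(pbox M) × Fin (d + 1)) o ℝ)
    (hW₁ : ∀ (b : ↥(pbox M) × Fin (d + 1)) (x : Res ρ N M), combBondT ρ N M x = ((b.1, Sum.inl b.2) : Idx M (Fib d)) → W₁ b = 0)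
    (hW₂ : ∀ (b : ↥(pbox M) × Fin (d + 1)) (x : Res ρ N M), combBondT ρ N M x = ((b.1, Sum.inl b.2) : Idx M (Fib d)) → W₂ b = 0) :
    secondVar ((combRowsT ρ N M).submatrix e.symm (fun b : ↥(pbox M) × Fin (d + 1) => ((b.1, Sum.inl b.2) : Idx M (Fib d))) * W₀)
        ((combRowsT ρ N M).submatrix e.symm (fun b : ↥(pbox M) × Fin (d + 1) => ((b.1, Sum.inl b.2) : Idx M (Fib d))) * W₁)
        ((combRowsT ρ N M).submatrix e.symm (fun b : ↥(pbox M) × Fin (d + 1) => ((b.1, Sum.inl b.2) : Idx M (Fib d))) * W₂) = 0 := by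
  rw [combSlice_mul_eq_zero_of_vanish_on_dead e W₁ hW₁, combSlice_mul_eq_zero_of_vanish_on_dead e W₂ hW₂]
  exact secondVar_zero_jets _

/-- [folklore] the same in an2's words: jets vanishing at every comb slot `(s, α)` with `IsCombBondAt ρ N α s`. -/
theorem secondVar_combSlice_jets_eq_zero_of_vanish_on_combSlots (hN : 0 < N) (hρ : ∀ i, 0 ≤ ρ i ∧ ρ i < N) (hM : ∀ i, N ∣ M i)
    (e : Res ρ N M ≃ o) (W₀ W₁ W₂ : Matrix (↥(pbox M) × Fin (d + 1)) o ℝ)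
    (hW₁ : ∀ b : ↥(pbox M) × Fin (d + 1), IsCombBondAt ρ N b.2 (b.1 : Site (d + 1)) → W₁ b = 0)
    (hW₂ : ∀ b : ↥(pbox M) × Fin (d + 1), IsCombBondAt ρ N b.2 (b.1 : Site (d + 1)) → W₂ b = 0) :
    secondVar ((combRowsT ρ N M).submatrix e.symm (fun b : ↥(pbox M) × Fin (d + 1) => ((b.1, Sum.inl b.2) : Idx M (Fib d))) * W₀)
        ((combRowsT ρ N M).submatrix e.symm (fun b : ↥(pbox M) × Fin (d + 1) => ((b.1, Sum.inl b.2) : Idx M (Fib d))) * W₁)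
        ((combRowsT ρ N M).submatrix e.symm (fun b : ↥(pbox M) × Fin (d + 1) => ((b.1, Sum.inl b.2) : Idx M (Fib d))) * W₂) = 0 :=
  secondVar_combSlice_jets_eq_zero_of_vanish_on_dead e W₀ W₁ W₂ (fun b _ h => hW₁ b (isCombBondAt_of_combBondT_eq hN hρ hM h))
    (fun b _ h => hW₂ b (isCombBondAt_of_combBondT_eq hN hρ hM h))

end OneShot

/-! ## §4 At the torus call's literal one-shot slice `P` (big comb re-indexed by `resBigEquiv`, field slots of the fine box) -/

section Torus

variable {N N₂ : ℕ} {ρ ρ₂ : Site (d + 1)} {M' : Fin (d + 1) → ℕ}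

/-- [folklore] **LIVE INSERTION SLOT OF THE ONE-SHOT (BIG-COMB) CHART ⇒ THE DISPLAYED ONE-SHOT FP 2-JET VANISHES, ANY `W₀`** — at
`P := (combRowsT ((N:ℤ)•ρ₂+ρ) (N·N₂) (fine N M′)).submatrix resBigEquiv.symm fieldSlot` (the torus call's `P`). -/
theorem secondVar_bigCombSlice_rowJets_eq_zero_of_live (hN : 0 < N) (hρ : ∀ i, 0 ≤ ρ i ∧ ρ i < N) (hN₂ : 0 < N₂)
    (hρ₂ : ∀ i, 0 ≤ ρ₂ i ∧ ρ₂ i < N₂) (hM' : ∀ i, N₂ ∣ M' i)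
    (W₀ W₁ W₂ : Matrix (↥(pbox (fine N M')) × Fin (d + 1)) (Res ρ₂ N₂ M' ⊕ Res ρ N (fine N M')) ℝ)
    {b : ↥(pbox (fine N M')) × Fin (d + 1)} (hW₁ : ∀ q, q ≠ b → W₁ q = 0) (hW₂ : ∀ q, q ≠ b → W₂ q = 0)
    (hb : ¬ IsCombBondAt ((N : ℤ) • ρ₂ + ρ) (N * N₂) b.2 (b.1 : Site (d + 1))) :
    secondVar
        (((combRowsT ((N : ℤ) • ρ₂ + ρ) (N * N₂) (fine N M')).submatrix (resBigEquiv N N₂ ρ ρ₂ M' hN hρ hN₂ hρ₂).symm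
          (fun b : ↥(pbox (fine N M')) × Fin (d + 1) => ((b.1, Sum.inl b.2) : Idx (fine N M') (Fib d)))) * W₀)
        (((combRowsT ((N : ℤ) • ρ₂ + ρ) (N * N₂) (fine N M')).submatrix (resBigEquiv N N₂ ρ ρ₂ M' hN hρ hN₂ hρ₂).symm
          (fun b : ↥(pbox (fine N M')) × Fin (d + 1) => ((b.1, Sum.inl b.2) : Idx (fine N M') (Fib d)))) * W₁)
        (((combRowsT ((N : ℤ) • ρ₂ + ρ) (N * N₂) (fine N M')).submatrix (resBigEquiv N N₂ ρ ρ₂ M' hN hρ hN₂ hρ₂).symm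
          (fun b : ↥(pbox (fine N M')) × Fin (d + 1) => ((b.1, Sum.inl b.2) : Idx (fine N M') (Fib d)))) * W₂) = 0 :=
  secondVar_combSlice_rowJets_eq_zero_of_not_isCombBondAt (Nat.mul_pos hN hN₂) (bigRoot_bounds hN hρ hρ₂) (fine_dvd hM') _ W₀ W₁ W₂ hW₁ hW₂ hb

/-- [folklore] **DEAD INSERTION SLOT OF THE ONE-SHOT CHART ⇒ THE DISPLAYED ONE-SHOT FP 2-JET IS `d₂ − d₁²`** at the torus call's `P`, for the big-comb
residual parameter `x` whose comb bond the slot is. -/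
theorem secondVar_bigCombSlice_rowJets_eq_of_dead (hN : 0 < N) (hρ : ∀ i, 0 ≤ ρ i ∧ ρ i < N) (hN₂ : 0 < N₂)
    (hρ₂ : ∀ i, 0 ≤ ρ₂ i ∧ ρ₂ i < N₂) (hM' : ∀ i, N₂ ∣ M' i)
    (W₀ W₁ W₂ : Matrix (↥(pbox (fine N M')) × Fin (d + 1)) (Res ρ₂ N₂ M' ⊕ Res ρ N (fine N M')) ℝ)
    {b : ↥(pbox (fine N M')) × Fin (d + 1)} (hW₁ : ∀ q, q ≠ b → W₁ q = 0) (hW₂ : ∀ q, q ≠ b → W₂ q = 0)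
    {x : Res ((N : ℤ) • ρ₂ + ρ) (N * N₂) (fine N M')} (hb : combBondT ((N : ℤ) • ρ₂ + ρ) (N * N₂) (fine N M') x = ((b.1, Sum.inl b.2) : Idx (fine N M') (Fib d))) :
    secondVar
        (((combRowsT ((N : ℤ) • ρ₂ + ρ) (N * N₂) (fine N M')).submatrix (resBigEquiv N N₂ ρ ρ₂ M' hN hρ hN₂ hρ₂).symm
          (fun b : ↥(pbox (fine N M')) × Fin (d + 1) => ((b.1, Sum.inl b.2) : Idx (fine N M') (Fib d)))) * W₀)
        (((combRowsT ((N : ℤ) • ρ₂ + ρ) (N * N₂) (fine N M')).submatrix (resBigEquiv N N₂ ρ ρ₂ M' hN hρ hN₂ hρ₂).symm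
          (fun b : ↥(pbox (fine N M')) × Fin (d + 1) => ((b.1, Sum.inl b.2) : Idx (fine N M') (Fib d)))) * W₁)
        (((combRowsT ((N : ℤ) • ρ₂ + ρ) (N * N₂) (fine N M')).submatrix (resBigEquiv N N₂ ρ ρ₂ M' hN hρ hN₂ hρ₂).symm
          (fun b : ↥(pbox (fine N M')) × Fin (d + 1) => ((b.1, Sum.inl b.2) : Idx (fine N M') (Fib d)))) * W₂)
      = W₂ b ⬝ᵥ (fun c => (((combRowsT ((N : ℤ) • ρ₂ + ρ) (N * N₂) (fine N M')).submatrix (resBigEquiv N N₂ ρ ρ₂ M' hN hρ hN₂ hρ₂).symm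
              (fun b : ↥(pbox (fine N M')) × Fin (d + 1) => ((b.1, Sum.inl b.2) : Idx (fine N M') (Fib d)))) * W₀)⁻¹ c
            (resBigEquiv N N₂ ρ ρ₂ M' hN hρ hN₂ hρ₂ x))
        - (W₁ b ⬝ᵥ fun c => (((combRowsT ((N : ℤ) • ρ₂ + ρ) (N * N₂) (fine N M')).submatrix (resBigEquiv N N₂ ρ ρ₂ M' hN hρ hN₂ hρ₂).symm
              (fun b : ↥(pbox (fine N M')) × Fin (d + 1) => ((b.1, Sum.inl b.2) : Idx (fine N M') (Fib d)))) * W₀)⁻¹ c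
            (resBigEquiv N N₂ ρ ρ₂ M' hN hρ hN₂ hρ₂ x)) ^ 2 :=
  secondVar_combSlice_rowJets_eq_of_dead (Nat.mul_pos hN hN₂) (bigRoot_bounds hN hρ hρ₂) (fine_dvd hM') _ W₀ W₁ W₂ hW₁ hW₂ hb

/-- [folklore] **THE TORUS CALL's ONE-SHOT FP DEFECT TERM VANISHES FOR GENERATOR JETS WITHOUT BIG-DEAD COMPONENTS** (presentation T-α, (O2)): at the
literal `P`, for ANY `W₀` and any `W₁ W₂` vanishing at every big-comb slot, `secondVar (P·W₀) (P·W₁) (P·W₂) = 0`. -/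
theorem secondVar_bigCombSlice_jets_eq_zero_of_vanish_on_dead (hN : 0 < N) (hρ : ∀ i, 0 ≤ ρ i ∧ ρ i < N) (hN₂ : 0 < N₂)
    (hρ₂ : ∀ i, 0 ≤ ρ₂ i ∧ ρ₂ i < N₂) (hM' : ∀ i, N₂ ∣ M' i)
    (W₀ W₁ W₂ : Matrix (↥(pbox (fine N M')) × Fin (d + 1)) (Res ρ₂ N₂ M' ⊕ Res ρ N (fine N M')) ℝ)
    (hW₁ : ∀ b : ↥(pbox (fine N M')) × Fin (d + 1), IsCombBondAt ((N : ℤ) • ρ₂ + ρ) (N * N₂) b.2 (b.1 : Site (d + 1)) → W₁ b = 0)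
    (hW₂ : ∀ b : ↥(pbox (fine N M')) × Fin (d + 1), IsCombBondAt ((N : ℤ) • ρ₂ + ρ) (N * N₂) b.2 (b.1 : Site (d + 1)) → W₂ b = 0) :
    secondVar
        (((combRowsT ((N : ℤ) • ρ₂ + ρ) (N * N₂) (fine N M')).submatrix (resBigEquiv N N₂ ρ ρ₂ M' hN hρ hN₂ hρ₂).symm
          (fun b : ↥(pbox (fine N M')) × Fin (d + 1) => ((b.1, Sum.inl b.2) : Idx (fine N M') (Fib d)))) * W₀)
        (((combRowsT ((N : ℤ) • ρ₂ + ρ) (N * N₂) (fine N M')).submatrix (resBigEquiv N N₂ ρ ρ₂ M' hN hρ hN₂ hρ₂).symm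
          (fun b : ↥(pbox (fine N M')) × Fin (d + 1) => ((b.1, Sum.inl b.2) : Idx (fine N M') (Fib d)))) * W₁)
        (((combRowsT ((N : ℤ) • ρ₂ + ρ) (N * N₂) (fine N M')).submatrix (resBigEquiv N N₂ ρ ρ₂ M' hN hρ hN₂ hρ₂).symm
          (fun b : ↥(pbox (fine N M')) × Fin (d + 1) => ((b.1, Sum.inl b.2) : Idx (fine N M') (Fib d)))) * W₂) = 0 :=
  secondVar_combSlice_jets_eq_zero_of_vanish_on_combSlots (Nat.mul_pos hN hN₂) (bigRoot_bounds hN hρ hρ₂) (fine_dvd hM') _ W₀ W₁ W₂ hW₁ hW₂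

end Torus

end Summit.QuantumFields.BalabanUV.Beta.FP.CombSliceRowJets

end
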